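import Mathlib.LinearAlgebra.PiTensorProduct.Basic
import Mathlib.LinearAlgebra.Pi
import Mathlib.LinearAlgebra.Span.Defs
import Mathlib.Data.Real.Basic
import Mathlib.Data.Set.Finite.Basic
import HarnessLib

/-!
# [IUTchIII] Theorem 3.11 in the author's terms, A: index data, mono-analytic log-shells, tensor packets, (Ind1), (Ind2)

Record-only file (D-0012) of the abc-iut cell (Cor. 3.12 sub-crew, seat abc-iut-c312-1); TAKES NO SIDE.
The fork skeleton `Summits/ABC/IUTFork/Fork*.lean` types the disputed step at the level of real numbers
and, one level below, of regions in an abstract volume container (`ForkRegions`, `ForkInflation`: the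
slots (Ind1), (Ind2), (Ind3) are abstract groups / an abstract enlargement). This file and its sequels
(`Thm311Multirad`, `Thm311LogKummer`, `Thm311LinkCompat`) type the STATEMENT of [IUTchIII] Theorem 3.11
(kurims May-2020 manuscript `paper:url-4b091feeb646`, pp. 153–158; PRIMS 57 pp. 573–580) one declaration
per printed sub-item, in the AUTHOR'S vocabulary, over NAMED SIGNATURES for the objects the statement
quotes from the 27-item layer-1 closure ([IUTchI] Def 3.1, 5.2, Prop 6.9, Cor 6.10; [IUTchII] Prop 4.2,
Cor 4.6, 4.7, 4.8, 4.10, 4.11; [IUTchIII] Prop 1.2, Thm 1.5, Prop 2.1, Thm 2.2, Cor 2.3, Prop 3.2, 3.4,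
3.5, 3.7, Def 3.8, Prop 3.9, 3.10, Rmk 2.3.2, 3.1.1, 3.8.2, 3.9.5, 3.11.4). A SIGNATURE is a structure
whose fields are the carriers and maps a cited construction supplies, each with its locator and the
wave-1 seat (HOME/README.md §WAVE 1) whose Literature file will replace it (`TODO-merge:<seat>`); nothing
about the construction itself is assumed beyond what Theorem 3.11 uses.

## This file

* `ThetaIndex` — the index skeleton of initial Θ-data ([IUTchI] Def. 3.1): `l = 2l⋇ + 1`, the sets of
  valuations `V → V_ℚ` with finite fibres, `V^non_ℚ`/`V^arc_ℚ`, `V^bad`; the labels `|F_l| = {0,…,l⋇}`,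
  `F_l^⋇ = {1,…,l⋇}`, and the capsule index sets `S^±_{j+1} = {0,…,j}` of the procession
  ([IUTchI] Prop. 6.9 (i)/(ii)).
* `LogShells` — SIGNATURE for the mono-analytic log-shells `I_{†D⊢_v} ⊆ log(†D⊢_v)` of [IUTchIII]
  Prop. 1.2 (vi), (vii), with the two sets of automorphisms Theorem 3.11 (i) lets act on them: those
  induced by isomorphisms of `D⊢`-prime-strips (functoriality of Prop. 1.2 (vi): "a functorial algorithm
  in the category `†D⊢_v`"), and "Ism" (Prop. 1.2 (vi); [IUTchII] Ex. 1.8 (iv)) resp. the order-2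
  automorphisms of Prop. 1.2 (vii).
* DEFINED over the signature with Mathlib's `PiTensorProduct`: the 1-tensor packet
  `log(D⊢_{v_ℚ}) = ⊕_{V ∋ v | v_ℚ} log(D⊢_v)` and the `(j+1)`-tensor packet
  `log(^{S^±_{j+1}}D⊢_{v_ℚ}) = ⊗_{i ∈ S^±_{j+1}} log(D⊢_{v_ℚ})` of [IUTchIII] Prop. 3.2 (tensor product
  "[say, over `ℚ`]", Rmk. 3.1.1 (i)); the sub-packet `log(^{S^±_{j+1}, j}D⊢_v)`; and the indeterminacies
  (Ind1), (Ind2) of Theorem 3.11 (i) p. 154 as EXPLICIT SETS OF LINEAR AUTOMORPHISMS of these packets —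
  (Ind1) = permutations of the `j+1` capsule indices together with strip-automorphisms in each factor
  (the automorphisms of the procession, [IUTchI] Def. 4.10 + §0 "capsule-full poly-isomorphism"),
  shared by all `v_ℚ` at a given label `j`; (Ind2) = "independent copies of Ism … on each of the direct
  summands of the `j+1` factors". Dupuy–Hilado §4.7–4.10 (arXiv:2004.13228) print the same two actions
  on `⊗ K_{v_i}`; the DH-level instantiation is seat abc-iut-c312-3's (TRANCHE-T1 P10).

## Modelling notes (what is and is not faithful)

* Ind-topological modules are modelled as `ℚ`-modules; topology enters only through the admissibility
  predicates of the log-volume signatures in the sequel (Prop. 3.9: `M(−)` = compact open subsets).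
* STRICTIFICATION: one carrier `log⊢_v` per `v ∈ V` on which isomorphisms of `D⊢`-prime-strips ACT
  (field `stripAut`), instead of one module per strip. Theorem 3.11 never distinguishes isomorphic
  carriers; the procession's `j+1` strips at label `j` become `j+1` tensor factors of the same module,
  permuted by (Ind1) (Dupuy–Hilado §4.7 make the same choice: "`x_0 ⊗ ⋯ ⊗ x_j ↦` permuted").
* At `v_ℚ ∈ V^arc_ℚ` the field `ism` holds the group generated by "the automorphisms of order 2 whose
  orbit constitutes the poly-automorphism discussed in Proposition 1.2, (vii)"; at `v_ℚ ∈ V^non_ℚ` it is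
  "Ism". One field, two readings by place — as in the printed (Ind2).

Sources read on the page: [IUTchIII] pp. 30–33 (Prop. 1.2), 92–99 (Prop. 3.1, Rmk. 3.1.1, Prop. 3.2),
153–154 (Thm. 3.11 (i), (Ind1), (Ind2)); [IUTchI] pp. 33–34 (§0 poly-morphisms, capsules), 119–120
(Def. 4.10 processions), 169 (Prop. 6.9). [claim: Mochizuki2012, status: disputed]
[cite: DupuyHilado2025, §4.7–4.10]
Deliberately NOT here: the data (a)(b)(c), log-volumes, `R^LGP`, and the statements (i)–(iii) (sequel
files); any real construction of a log-shell (campaign M layers L4/L6); any judgement.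
-/

noncomputable section

open scoped TensorProduct

namespace Summit.ABC

namespace IUTFork

namespace Thm311

/-! ## 1. The index skeleton of initial Θ-data -/

/-- The INDEX SKELETON of a collection of initial Θ-data `(F̄/F, X_F, l, C_K, V, V^bad_mod, ε)`
([IUTchI] Def. 3.1): the prime `l ≥ 5` written `l = 2l⋇ + 1` (Def. 3.1 (c); [IUTchI] §0 `l⋇ = (l−1)/2`),
the set `V` of valuations of `K` chosen in Def. 3.1 (e) (a section of `V(K) → V_mod`), the set `V_ℚ` of
places of `ℚ` with the surjection `V → V_ℚ` with FINITE fibres (Rmk. 3.1.1 (ii): "direct sums over all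
`v ∈ V` lying over a given `v_ℚ`"; Rmk. 3.9.1 (i): "`{v_1, …, v_{n_{v_ℚ}}}` for the [distinct!] elements of
`V` that lie over `v_ℚ`"), the partition `V_ℚ = V^non_ℚ ⊔ V^arc_ℚ`, and the nonempty finite set
`V^bad ⊆ V` of bad places, all nonarchimedean (Def. 3.1 (b), (c): "`V^bad_mod` … nonempty set of
nonarchimedean valuations of `F_mod` of odd residue characteristic"). SIGNATURE (index data only; the
number field, the curve and `ε` are campaign-M objects). TODO-merge: abc-iut-L5-t2 ([IUTchI] Def. 3.1).
[claim: Mochizuki2012, status: disputed] -/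
structure ThetaIndex where
  /-- `l⋇ = (l − 1)/2` -/
  lstar : ℕ
  /-- `l ≥ 5`, i.e. `l⋇ ≥ 2` -/
  two_le_lstar : 2 ≤ lstar
  /-- the valuations `V` (≅ `V_mod`, Def. 3.1 (e)) -/
  V : Type
  /-- the places `V_ℚ` of `ℚ` -/
  VQ : Type
  /-- `v ↦ v_ℚ`, the place of `ℚ` under `v` -/
  over : V → VQ
  /-- `v_ℚ ∈ V^non_ℚ` (its negation: `v_ℚ ∈ V^arc_ℚ`) -/
  IsNon : VQ → Prop
  /-- every fibre `{v ∈ V | v | v_ℚ}` is finite -/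
  fibre_finite : ∀ vQ : VQ, Set.Finite {v : V | over v = vQ}
  /-- and nonempty -/
  fibre_nonempty : ∀ vQ : VQ, ∃ v : V, over v = vQ
  /-- `V^bad ⊆ V` -/
  Vbad : Set V
  /-- `V^bad ≠ ∅` -/
  Vbad_nonempty : Vbad.Nonempty
  /-- `V^bad` is finite -/
  Vbad_finite : Vbad.Finite
  /-- bad places are nonarchimedean -/
  Vbad_non : ∀ v ∈ Vbad, IsNon (over v)

namespace ThetaIndex

variable (T : ThetaIndex)

/-- `l = 2l⋇ + 1`. [claim: Mochizuki2012, status: disputed] -/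
def l : ℕ := 2 * T.lstar + 1

/-- `l ≥ 5`. [folklore] -/
theorem five_le_l : 5 ≤ T.l := by
  have := T.two_le_lstar; unfold l; omega

/-- The labels `|F_l| = F_l/{±1} = {0, 1, …, l⋇}` ([IUTchI] §0; Thm. 3.11 (i) (a): "`j ∈ |F_l|`").
[claim: Mochizuki2012, status: disputed] -/
abbrev Label : Type := Fin (T.lstar + 1)

/-- The nonzero labels `F_l^⋇ = {1, …, l⋇} ⊆ |F_l|` (Thm. 3.11 (i) (b), (c): "`j ∈ F_l^⋇`").
[claim: Mochizuki2012, status: disputed] -/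
def LabelStar : Type := {j : T.Label // j ≠ 0}

/-- The index set `S^±_{j+1} = {0, 1, …, j}` of the `(j+1)`-capsule of the procession at label `j`
([IUTchI] Prop. 6.9 (i): "`S^±_t = {0, 1, 2, …, t−1}`"; [IUTchIII] Prop. 3.4 (ii): "for `j ∈ {1, …, l⋇}`,
the index set of the `(j+1)`-capsule that appears in such a procession is denoted `S^±_{j+1}`").
[claim: Mochizuki2012, status: disputed] -/
abbrev Caps (j : T.Label) : Type := Fin ((j : ℕ) + 1)

/-- The label `j` itself as an element of `S^±_{j+1} = {0, …, j}` (its last element) — the "`α`" of the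
sub-packets `log(^{S^±_{j+1}, j}(−)_v)` of Prop. 3.1 (ii)/3.2. [claim: Mochizuki2012, status: disputed] -/
def selfIndex (j : T.Label) : T.Caps j := Fin.last (j : ℕ)

/-- The (finite, nonempty) fibre `{v ∈ V | v | v_ℚ}`. [claim: Mochizuki2012, status: disputed] -/
def Fibre (vQ : T.VQ) : Type := {v : T.V // T.over v = vQ}

/-- The fibre over `v_ℚ` is finite. [folklore] -/
instance (vQ : T.VQ) : Finite (T.Fibre vQ) :=
  (T.fibre_finite vQ).to_subtype

/-- The fibre over `v_ℚ` is nonempty. [folklore] -/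
instance (vQ : T.VQ) : Nonempty (T.Fibre vQ) := by
  obtain ⟨v, hv⟩ := T.fibre_nonempty vQ
  exact ⟨⟨v, hv⟩⟩

/-- `v` as an element of the fibre over its own `v_ℚ`. [folklore] -/
def toFibre (v : T.V) : T.Fibre (T.over v) := ⟨v, rfl⟩

end ThetaIndex

/-! ## 2. Mono-analytic log-shells (signature) -/

/-- SIGNATURE for the MONO-ANALYTIC LOG-SHELLS of a `D⊢`-prime-strip, [IUTchIII] Prop. 1.2 (vi) (at
`v ∈ V^non`): "the algorithms for constructing "`k~(G)`", "`I(G)`" given in [AbsTopIII], Proposition 5.8,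
(ii), yield a functorial algorithm in the category `†D⊢_v` for constructing an ind-topological module
equipped with a continuous `†G_v`-action `log(†D⊢_v) := {†G_v ↷ k~(†G_v)}` and a topological submodule —
i.e., a "mono-analytic log-shell" — `I_{†D⊢_v} := I(†G_v) ⊆ k~(†G_v)`", "… a functorial algorithm … for
constructing an Ism-orbit of isomorphisms `log(†D⊢_v) ⥲ log(†F⊢×μ_v)`"; (vii) (at `v ∈ V^arc`): "a
topological module `log(†D⊢_v) := k~(†G_v)` and a topological subspace `I_{†D⊢_v} := I(†G_v)`", "a
poly-isomorphism [i.e., an orbit of isomorphisms with respect to the independent actions of `{±1}` on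
each of the direct factors that occur in the construction of [AbsTopIII], Proposition 5.8, (v)]".
One carrier per `v ∈ V` (strictification, see the module docstring); `stripAut v` = the automorphisms of
`log⊢_v` induced, by functoriality, by isomorphisms of `D⊢`-prime-strips at `v`; `ism v` = Ism (`v` non) /
the group generated by the order-2 automorphisms (`v` arc). TODO-merge: abc-iut-L6-t3 ([IUTchIII]
Prop. 1.2), abc-iut-L4-t3 ([AbsTopIII] Prop. 5.8), abc-iut-L6-t1 ([IUTchII] Ex. 1.8 (iv) "Ism").
[claim: Mochizuki2012, status: disputed] -/
structure LogShells (T : ThetaIndex) where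
  /-- `log(D⊢_v)` ("`k~(G_v)`"), as a `ℚ`-module -/
  carrier : T.V → Type
  [acg : ∀ v, AddCommGroup (carrier v)]
  [mod : ∀ v, Module ℚ (carrier v)]
  /-- the mono-analytic log-shell `I_{D⊢_v} ⊆ log(D⊢_v)` -/
  shell : ∀ v, Set (carrier v)
  /-- automorphisms of `log(D⊢_v)` induced by isomorphisms of `D⊢`-prime-strips (Prop. 1.2 (vi) functoriality) -/
  stripAut : ∀ v, Set (carrier v ≃ₗ[ℚ] carrier v)
  /-- "Ism" (Prop. 1.2 (vi)) at nonarchimedean `v`; the order-2 sign automorphisms (Prop. 1.2 (vii)) at archimedean `v` -/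
  ism : ∀ v, Set (carrier v ≃ₗ[ℚ] carrier v)
  /-- the identity is induced by the identity isomorphism of strips -/
  one_mem_stripAut : ∀ v, LinearEquiv.refl ℚ (carrier v) ∈ stripAut v
  /-- the identity is an element of Ism / of the sign group -/
  one_mem_ism : ∀ v, LinearEquiv.refl ℚ (carrier v) ∈ ism v

namespace LogShells

variable {T : ThetaIndex} (L : LogShells T)

/-- `log(D⊢_v)` is an abelian group (signature field). [folklore] -/
instance (v : T.V) : AddCommGroup (L.carrier v) := L.acg v

/-- `log(D⊢_v)` is a `ℚ`-module (signature field). [folklore] -/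
instance (v : T.V) : Module ℚ (L.carrier v) := L.mod v

/-- The 1-TENSOR PACKET `log(D⊢_{v_ℚ}) := ⊕_{V ∋ v | v_ℚ} log(D⊢_v)` ([IUTchIII] Prop. 3.2, first display;
finite direct sum = product over the finite fibre). [claim: Mochizuki2012, status: disputed] -/
def Packet1 (vQ : T.VQ) : Type := ∀ v : T.Fibre vQ, L.carrier v.1

/-- The 1-tensor packet is an abelian group (product structure). [folklore] -/
instance (vQ : T.VQ) : AddCommGroup (L.Packet1 vQ) := inferInstanceAs (AddCommGroup (∀ v : T.Fibre vQ, _))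
/-- The 1-tensor packet is a `ℚ`-module (product structure). [folklore] -/
instance (vQ : T.VQ) : Module ℚ (L.Packet1 vQ) := inferInstanceAs (Module ℚ (∀ v : T.Fibre vQ, _))

/-- The `(j+1)`-TENSOR PACKET `log(^{S^±_{j+1}}D⊢_{v_ℚ}) := ⊗_{i ∈ S^±_{j+1}} log(D⊢_{i, v_ℚ})` of the
`(j+1)`-capsule of `D⊢`-prime-strips at label `j` of the procession ([IUTchIII] Prop. 3.2, second display:
"`log(^A D⊢_{v_ℚ}) := ⊗_{α ∈ A} log(^α D⊢_{v_ℚ})` — where the tensor product is to be understood as a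
tensor product of ind-topological modules"; Rmk. 3.1.1 (i): "[say, over `ℚ`]"); here `A = S^±_{j+1}` and,
by strictification, every factor is the same module `log(D⊢_{v_ℚ})`. Its `ℚ`-span of the integral
structure is Theorem 3.11's `I^ℚ(^{S^±_{j+1}}D⊢_{v_ℚ})`. [claim: Mochizuki2012, status: disputed] -/
def Packet (j : T.Label) (vQ : T.VQ) : Type := ⨂[ℚ] _i : T.Caps j, L.Packet1 vQ

/-- The `(j+1)`-tensor packet is an abelian group (`PiTensorProduct` structure). [folklore] -/
instance (j : T.Label) (vQ : T.VQ) : AddCommGroup (L.Packet j vQ) :=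
  inferInstanceAs (AddCommGroup (⨂[ℚ] _i : T.Caps j, L.Packet1 vQ))
/-- The `(j+1)`-tensor packet is a `ℚ`-module (`PiTensorProduct` structure). [folklore] -/
instance (j : T.Label) (vQ : T.VQ) : Module ℚ (L.Packet j vQ) :=
  inferInstanceAs (Module ℚ (⨂[ℚ] _i : T.Caps j, L.Packet1 vQ))

/-- Pure tensors `x_0 ⊗ ⋯ ⊗ x_j` of the `(j+1)`-tensor packet. [folklore] -/
def tprod (j : T.Label) (vQ : T.VQ) (x : T.Caps j → L.Packet1 vQ) : L.Packet j vQ :=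
  PiTensorProduct.tprod ℚ x

/-- The SUB-PACKET `log(^{S^±_{j+1}, j}D⊢_v) ⊆ log(^{S^±_{j+1}}D⊢_{v_ℚ})` (`v | v_ℚ`): "the
ind-topological submodule determined by the tensor product of the factors labeled by `β ∈ A∖{α}` with
the tensor product of the direct summand with subscript `v` of the factor labeled `α`" ([IUTchIII]
Prop. 3.2, with Prop. 3.1 (ii)), for `A = S^±_{j+1}`, `α = j`: the `ℚ`-span of the pure tensors whose
`j`-th component is supported on the summand `v`. Theorem 3.11 (i) (a)/(b) place the splitting monoids
in (the `ℚ`-span of the integral structure of) this sub-packet. [claim: Mochizuki2012, status: disputed] -/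
def SubPacket (j : T.Label) (v : T.V) : Submodule ℚ (L.Packet j (T.over v)) :=
  Submodule.span ℚ
    {t | ∃ x : T.Caps j → L.Packet1 (T.over v),
      (∀ w : T.Fibre (T.over v), w.1 ≠ v → x (T.selfIndex j) w = 0) ∧ t = L.tprod j (T.over v) x}

/-! ## 3. (Ind1) and (Ind2) as explicit sets of automorphisms of the tensor packets -/

/-- The automorphism of the 1-tensor packet `⊕_{v | v_ℚ} log(D⊢_v)` acting by `g v` on the summand `v`
("independent copies … on each of the direct summands", Thm. 3.11 (i) (Ind2)). [folklore] -/
def summandwise (vQ : T.VQ) (g : ∀ v : T.Fibre vQ, L.carrier v.1 ≃ₗ[ℚ] L.carrier v.1) :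
    L.Packet1 vQ ≃ₗ[ℚ] L.Packet1 vQ :=
  LinearEquiv.piCongrRight g

/-- The automorphism of the `(j+1)`-tensor packet acting by `e i` on the `i`-th tensor factor. [folklore] -/
def factorwise (j : T.Label) (vQ : T.VQ) (e : T.Caps j → (L.Packet1 vQ ≃ₗ[ℚ] L.Packet1 vQ)) :
    L.Packet j vQ ≃ₗ[ℚ] L.Packet j vQ :=
  PiTensorProduct.congr e

/-- The automorphism of the `(j+1)`-tensor packet permuting the tensor factors by `σ ∈ Perm(S^±_{j+1})`
(the capsule-index part of an automorphism of the procession, [IUTchI] §0: "a capsule-full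
poly-isomorphism is a capsule-full poly-morphism for which the associated injection between index sets is
a bijection"; Dupuy–Hilado §4.7). [folklore] -/
def permute (j : T.Label) (vQ : T.VQ) (σ : Equiv.Perm (T.Caps j)) : L.Packet j vQ ≃ₗ[ℚ] L.Packet j vQ :=
  PiTensorProduct.reindex ℚ (fun _ : T.Caps j => L.Packet1 vQ) σ

/-- **(Ind1)** at label `j` ([IUTchIII] Thm. 3.11 (i), p. 154): "the indeterminacies induced by the
automorphisms of the procession of `D⊢`-prime-strips `Prc(^{n,∘}D⊢_T)`". By [IUTchI] Def. 4.10 and §0, an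
automorphism of the procession is, at each label `j`, a capsule-full poly-automorphism of the
`(j+1)`-capsule: a permutation `σ` of `S^±_{j+1}` together with [all] isomorphisms of `D⊢`-prime-strips
`D⊢_i ⥲ D⊢_{σ(i)}`; an isomorphism of `D⊢`-prime-strips is a collection of isomorphisms indexed by
`v ∈ V` ([IUTchI] Def. 4.1 (iv)), acting on `log(D⊢_v)` by functoriality (field `stripAut`). Induced on
the tensor packets: ONE permutation `σ` for every `v_ℚ` (it permutes the capsule), and an independent
strip-automorphism on the summand `v` of the factor `i` for every `(i, v)`. Typed as the SET of the
induced families of linear automorphisms `(v_ℚ ↦ Packet j v_ℚ ⥲ Packet j v_ℚ)`.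
[claim: Mochizuki2012, status: disputed] -/
def Ind1 (j : T.Label) : Set (∀ vQ : T.VQ, L.Packet j vQ ≃ₗ[ℚ] L.Packet j vQ) :=
  {Φ | ∃ (σ : Equiv.Perm (T.Caps j)) (h : T.Caps j → ∀ v : T.V, L.carrier v ≃ₗ[ℚ] L.carrier v),
      (∀ i v, h i v ∈ L.stripAut v) ∧
      ∀ vQ, Φ vQ = (L.permute j vQ σ).trans
        (L.factorwise j vQ fun i => L.summandwise vQ fun v => h i v.1)}

/-- **(Ind2)** at label `j` and place `v_ℚ` ([IUTchIII] Thm. 3.11 (i), p. 154): "for each `v_ℚ ∈ V^non_ℚ`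
(respectively, `v_ℚ ∈ V^arc_ℚ`), the indeterminacies induced by the action of independent copies of Ism
[cf. Proposition 1.2, (vi)] (respectively, copies of each of the automorphisms of order 2 whose orbit
constitutes the poly-automorphism discussed in Proposition 1.2, (vii)) on each of the direct summands of
the `j+1` factors appearing in the tensor product used to define `I^ℚ(^{S^±_{j+1}};^{n,∘}D⊢_{v_ℚ})` — where
we recall that the cardinality of the collection of direct summands is equal to the cardinality of the
set of `v ∈ V` that lie over `v_ℚ`". Typed as the SET of linear automorphisms of the packet acting by an
element of `ism v` on the summand `v` of the factor `i`, independently for every `(i, v)`.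
[claim: Mochizuki2012, status: disputed] -/
def Ind2 (j : T.Label) (vQ : T.VQ) : Set (L.Packet j vQ ≃ₗ[ℚ] L.Packet j vQ) :=
  {φ | ∃ g : T.Caps j → ∀ v : T.Fibre vQ, L.carrier v.1 ≃ₗ[ℚ] L.carrier v.1,
      (∀ i v, g i v ∈ L.ism v.1) ∧ φ = L.factorwise j vQ fun i => L.summandwise vQ (g i)}

/-- `summandwise` of identities is the identity. [folklore] -/
theorem summandwise_refl (vQ : T.VQ) :
    L.summandwise vQ (fun v => LinearEquiv.refl ℚ (L.carrier v.1)) = LinearEquiv.refl ℚ _ := by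
  apply LinearEquiv.ext; intro x; rfl

/-- `factorwise` of identities is the identity. [folklore] -/
theorem factorwise_refl (j : T.Label) (vQ : T.VQ) :
    L.factorwise j vQ (fun _ => LinearEquiv.refl ℚ (L.Packet1 vQ)) = LinearEquiv.refl ℚ _ := by
  apply LinearEquiv.toLinearMap_injective
  change PiTensorProduct.map (fun _ => LinearMap.id) = LinearMap.id
  exact PiTensorProduct.map_id

/-- `permute` by the identity permutation is the identity. [folklore] -/
theorem permute_refl (j : T.Label) (vQ : T.VQ) :
    L.permute j vQ (Equiv.refl _) = LinearEquiv.refl ℚ _ :=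
  PiTensorProduct.reindex_refl

/-- The family of summandwise identities is the family of identities. [folklore] -/
theorem summandwise_refl_family (j : T.Label) (vQ : T.VQ) :
    (fun _ : T.Caps j => L.summandwise vQ fun v => LinearEquiv.refl ℚ (L.carrier v.1)) =
      fun _ => LinearEquiv.refl ℚ (L.Packet1 vQ) := by
  funext i; exact L.summandwise_refl vQ

/-- The trivial indeterminacy lies in (Ind1): no data is forced to move. NON-VACUITY in the weak sense
(the set is inhabited); whether (Ind1) moves log-volumes is a property of the instantiated signature.
[folklore] -/
theorem refl_mem_Ind1 (j : T.Label) : (fun vQ => LinearEquiv.refl ℚ (L.Packet j vQ)) ∈ L.Ind1 j := by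
  refine ⟨Equiv.refl _, fun _ v => LinearEquiv.refl ℚ (L.carrier v), fun _ v => L.one_mem_stripAut v, ?_⟩
  intro vQ
  rw [permute_refl, summandwise_refl_family, factorwise_refl]
  rfl

/-- The trivial indeterminacy lies in (Ind2). [folklore] -/
theorem refl_mem_Ind2 (j : T.Label) (vQ : T.VQ) : LinearEquiv.refl ℚ (L.Packet j vQ) ∈ L.Ind2 j vQ := by
  refine ⟨fun _ v => LinearEquiv.refl ℚ (L.carrier v.1), fun _ v => L.one_mem_ism v.1, ?_⟩
  rw [summandwise_refl_family, factorwise_refl]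

/-- (Ind2) acts on pure tensors factor- and summand-wise: `φ(x_0 ⊗ ⋯ ⊗ x_j) = (g_0·x_0) ⊗ ⋯ ⊗ (g_j·x_j)`
with `(g_i·x_i)_v = g_{i,v}(x_{i,v})` — the printed "action … on each of the direct summands of the `j+1`
factors". [folklore] -/
theorem factorwise_summandwise_tprod (j : T.Label) (vQ : T.VQ)
    (g : T.Caps j → ∀ v : T.Fibre vQ, L.carrier v.1 ≃ₗ[ℚ] L.carrier v.1) (x : T.Caps j → L.Packet1 vQ) :
    L.factorwise j vQ (fun i => L.summandwise vQ (g i)) (L.tprod j vQ x) =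
      L.tprod j vQ (fun i => fun v => g i v (x i v)) :=
  PiTensorProduct.congr_tprod (fun i => L.summandwise vQ (g i)) x

/-- (Ind1)'s permutation part acts on pure tensors by permuting the factors:
`σ(x_0 ⊗ ⋯ ⊗ x_j) = ⊗_{i'} x_{σ⁻¹(i')}` (Dupuy–Hilado §4.7). [folklore] -/
theorem permute_tprod (j : T.Label) (vQ : T.VQ) (σ : Equiv.Perm (T.Caps j)) (x : T.Caps j → L.Packet1 vQ) :
    L.permute j vQ σ (L.tprod j vQ x) = L.tprod j vQ (fun i => x (σ.symm i)) := by
  unfold permute tprod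
  exact PiTensorProduct.reindex_tprod σ x

end LogShells

end Thm311

end IUTFork

end Summit.ABC

end
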